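import Literature.AnabelianGeometry.AbsoluteAnabelian.LocalUnramifiedFieldSubgroups
import HarnessLib

/-!
# The unramified criterion `I_F ≤ G_E ↔ #μ_{p'}(E) + 1 = q^[E:F]` (valued model; proofs only)

Second auxiliary file for the DISCHARGE of the LCFT input `mlf_unramified_criterion`
([AbsAnab] Prop 1.2.1 (ii) proof, p. 11; `MLFReciprocityInputs.lean`).  `F` is a non-archimedean
local field of characteristic `0` with residue field of cardinality `q` and residue characteristic
`p`, `E ⊆ F̄` a finite subextension, `μ_{p'}(E)` = `primeToRootsOfUnity p E` the roots of unity of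
order prime to `p` in `E`, `I_F = absInertia F`, `G_E = galFixing F E`.

* `fieldSubgroup_iff_dvd_of_absInertia_le` — if `I_F ≤ G_E` then `W_F ∩ G_E = deg⁻¹(mℤ)`,
  `m = [E:F]`.
* `natCard_primeToRootsOfUnity_eq_of_absInertia_le` — if `I_F ≤ G_E` then
  `#μ_{p'}(E) = q^[E:F] - 1` (the roots of unity in `E` of order prime to `p` are exactly the
  `(q^m-1)`-th roots of unity of `F̄`); in particular `#μ_{p'}(F) = q - 1`
  (`natCard_primeToRootsOfUnity_base`).
* `absInertia_le_galFixing_of_natCard_eq` — conversely `#μ_{p'}(E) + 1 = q^[E:F]` forces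
  `W_F ∩ G_E ⊇ deg⁻¹(mℤ) ⊇ I_F` (least positive degree + index count; `deg⁻¹(mℤ)` is the
  tree's `AbstractCFT.degMultiples`).

(Serre, *Local Fields* III §5 Thm 3, IV §4 Cor. 2 to Prop. 16; Neukirch, *ANT* II (7.12)–(7.13).)
Theorems only; no new definitions, no named facts.  HONEST FRAMING: classical; no bearing on
[IUTchIII] Cor. 3.12. [cite: MochizukiAbsAnab2004, Prop 1.2.1 (ii) proof p.11]
-/

noncomputable section

open Topology Filter Field ValuativeRel
open scoped Pointwise

namespace Literature.AnabelianGeometry.AbsoluteAnabelian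

open Literature.NumberTheory.GaloisRepresentations
open Literature.NumberTheory.GaloisRepresentations.IsNonarchimedeanLocalField
open Literature.NumberTheory.GaloisRepresentations.LocalWeilDatum

universe u

/-- Transport of `primeToRootsOfUnity` along a multiplicative equivalence.
[cite: MochizukiAbsAnab2004, Prop 1.2.1 (ii) proof p.11] -/
theorem natCard_primeToRootsOfUnity_congr {M N : Type*} [Monoid M] [Monoid N] (e : M ≃* N)
    (p : ℕ) : Nat.card (primeToRootsOfUnity p M) = Nat.card (primeToRootsOfUnity p N) := by
  have himage : e '' primeToRootsOfUnity p M = primeToRootsOfUnity p N := by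
    ext y
    constructor
    · rintro ⟨x, ⟨n, hn, hpn, hx⟩, rfl⟩
      exact ⟨n, hn, hpn, by rw [← map_pow, hx, map_one]⟩
    · rintro ⟨n, hn, hpn, hy⟩
      refine ⟨e.symm y, ⟨n, hn, hpn, ?_⟩, e.apply_symm_apply y⟩
      rw [← map_pow, hy, map_one]
  rw [← himage, Nat.card_image_of_injective e.injective]

section Local

variable (F : Type u) [Field F] [ValuativeRel F] [TopologicalSpace F] [IsNonarchimedeanLocalField F]
  [CharZero F]

variable {F}

omit [CharZero F] in
/-- An element of the inertia group `I_F ⊆ Γ_F`, as an element of the Weil group of degree `0`.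
[cite: MochizukiAbsAnab2004, Prop 1.2.1 (ii) proof p.11] -/
theorem exists_weilGroup_of_mem_absInertia {σ : absoluteGaloisGroup F} (hσ : σ ∈ absInertia F) :
    ∃ w : WeilGroup F, WeilGroup.toAbsGalois F w = σ ∧ WeilGroup.deg w = 0 := by
  have h0 : IsFrobPow σ 0 := isFrobPow_zero_iff_mem_absInertia.mpr hσ
  refine ⟨WeilGroup.mk σ ⟨0, h0⟩, WeilGroup.toAbsGalois_mk σ _, ?_⟩
  exact (WeilGroup.deg_eq_iff IsFrobPow.mul_holds IsFrobPow.unique_holds).mpr h0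

/-- **`I_F ≤ G_E` ⇒ `W_F ∩ G_E = deg⁻¹([E:F] ℤ)`**: the Weil subgroup of an unramified finite
subextension consists of the elements whose degree is a multiple of the degree of the extension.
[cite: MochizukiAbsAnab2004, Prop 1.2.1 (ii) proof p.11] -/
theorem fieldSubgroup_iff_dvd_of_absInertia_le (E : IntermediateField F (AlgebraicClosure F))
    [FiniteDimensional F E] (hI : absInertia F ≤ galFixing F E) (w : WeilGroup F) :
    w ∈ fieldSubgroup F E ↔ ((Module.finrank F E : ℕ) : ℤ) ∣ WeilGroup.deg w := by
  haveI := finiteIndex_fieldSubgroup F E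
  obtain ⟨m, hm, ⟨w₀, hw₀U, hw₀⟩, hdvd⟩ := exists_least_pos_deg (fieldSubgroup F E)
  have hDm : ∀ v : WeilGroup F, v ∈ AbstractCFT.degMultiples (degHom F) m ↔
      (m : ℤ) ∣ WeilGroup.deg v := fun v => by
    rw [AbstractCFT.mem_degMultiples_iff, degZ_degHom]
  have hUD : fieldSubgroup F E = AbstractCFT.degMultiples (degHom F) m := by
    refine le_antisymm (fun v hv => (hDm v).mpr (hdvd v hv)) (fun v hv => ?_)
    obtain ⟨a, ha⟩ := (hDm v).mp hv
    -- `v * w₀^(-a)` has degree `0`, hence lies in `I_F ≤ G_E`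
    have hdeg : WeilGroup.deg (v * w₀ ^ (-a)) = 0 := by
      rw [WeilGroup.deg_mul IsFrobPow.mul_holds IsFrobPow.unique_holds, WeilGroup.deg_zpow, hw₀,
        ha]; ring
    have hmem : v * w₀ ^ (-a) ∈ fieldSubgroup F E := by
      rw [← toAbsGalois_mem_galFixing_iff]
      apply hI
      rw [← WeilGroup.mem_inertia_iff]
      exact (WeilGroup.deg_eq_zero_iff_mem_inertia IsFrobPow.mul_holds IsFrobPow.unique_holds).mp
        hdeg
    have := (fieldSubgroup F E).mul_mem hmem ((fieldSubgroup F E).zpow_mem hw₀U a)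
    rwa [mul_assoc, ← zpow_add, neg_add_cancel, zpow_zero, mul_one] at this
  have hidx : (fieldSubgroup F E).index = m := by
    rw [hUD]; exact index_degMultiples hm _ hDm
  have hfin : Module.finrank F E = m := by
    rw [← index_galFixing_eq_finrank, ← index_fieldSubgroup_eq, hidx]
  rw [hfin, hUD, hDm]

/-- **Roots of unity in an unramified subextension.**  If `I_F ≤ G_E` and `p` is the residue
characteristic, the roots of unity of `E` of order prime to `p` are exactly the
`(q^[E:F] - 1)`-th roots of unity of `F̄`, so `#μ_{p'}(E) = q^[E:F] - 1`.
[cite: MochizukiAbsAnab2004, Prop 1.2.1 (ii) proof p.11] -/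
theorem natCard_primeToRootsOfUnity_eq_of_absInertia_le {p : ℕ} (hp : ringChar 𝓀[F] = p)
    (E : IntermediateField F (AlgebraicClosure F)) [FiniteDimensional F E]
    (hI : absInertia F ≤ galFixing F E) :
    Nat.card (primeToRootsOfUnity p E) = residueFieldCard F ^ Module.finrank F E - 1 := by
  classical
  set n := Module.finrank F E with hn
  have hnpos : 0 < n := Module.finrank_pos
  set M := residueFieldCard F ^ n - 1 with hM
  have hM0 : M ≠ 0 := residueFieldCard_pow_sub_one_ne_zero F n hnpos
  have hMp : ¬ ringChar 𝓀[F] ∣ M := not_ringChar_dvd_residueFieldCard_pow_sub_one F hnpos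
  have hU := fieldSubgroup_iff_dvd_of_absInertia_le E hI
  -- the comparison map to the `M`-th roots of unity of `F̄`
  let S := {x : AlgebraicClosure F // x ∈ Polynomial.nthRoots M (1 : AlgebraicClosure F)}
  have hS : ∀ x : AlgebraicClosure F, x ∈ Polynomial.nthRoots M (1 : AlgebraicClosure F) ↔
      x ^ M = 1 := fun x => Polynomial.mem_nthRoots (Nat.pos_of_ne_zero hM0)
  let ι : primeToRootsOfUnity p E → S := fun x => ⟨((x.1 : E) : AlgebraicClosure F), by
    obtain ⟨N, hN, hpN, hxN⟩ := x.2
    rw [hS]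
    have hζN : ((x.1 : E) : AlgebraicClosure F) ^ N = 1 := by
      rw [← SubmonoidClass.coe_pow, hxN]; rfl
    rw [← hp] at hpN
    refine (smul_eq_self_iff_pow_eq_one_of_forall_dvd hpN hN.ne' n hζN).mp fun w hw => ?_
    exact (mem_fieldSubgroup_iff F).mp ((hU w).mpr hw) _ (x.1 : E).2⟩
  have hι : Function.Bijective ι := by
    constructor
    · intro x y hxy
      have h := congrArg Subtype.val hxy
      exact Subtype.ext (Subtype.ext h)
    · rintro ⟨ζ, hζ⟩
      rw [hS] at hζ
      -- `ζ ∈ E`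
      have hζE : ζ ∈ E := by
        rw [mem_iff_forall_fieldSubgroup_smul E ζ]
        intro w hw
        exact (smul_eq_self_iff_pow_eq_one_of_forall_dvd hMp hM0 n hζ).mpr hζ w ((hU w).mp hw)
      refine ⟨⟨⟨ζ, hζE⟩, M, Nat.pos_of_ne_zero hM0, hp ▸ hMp, ?_⟩, rfl⟩
      apply Subtype.ext
      rw [SubmonoidClass.coe_pow]
      exact hζ
  rw [Nat.card_eq_of_bijective ι hι]
  -- `#S = M`
  haveI : NeZero M := ⟨hM0⟩
  haveI : NeZero (M : F) := ⟨by exact_mod_cast hM0⟩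
  have h1 : Nat.card S = Nat.card (rootsOfUnity M (AlgebraicClosure F)) :=
    Nat.card_congr (rootsOfUnityEquivNthRoots (AlgebraicClosure F) M).symm
  rw [h1, HasEnoughRootsOfUnity.natCard_rootsOfUnity]

/-- `#μ_{p'}(F) = q - 1`: the roots of unity of order prime to `p` in `F` itself are the
`(q-1)`-th roots of unity (Teichmüller representatives of `k^×`), via `E = F = ⊥`.
[cite: MochizukiAbsAnab2004, Prop 1.2.1 (iii) proof p.11] -/
theorem natCard_primeToRootsOfUnity_base {p : ℕ} (hp : ringChar 𝓀[F] = p) :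
    Nat.card (primeToRootsOfUnity p F) = residueFieldCard F - 1 := by
  have h := natCard_primeToRootsOfUnity_eq_of_absInertia_le hp (⊥ : IntermediateField F _)
    (by rw [galFixing_bot]; exact le_top)
  rw [IntermediateField.finrank_bot, pow_one] at h
  rw [← h]
  exact (natCard_primeToRootsOfUnity_congr
    ((IntermediateField.botEquiv F (AlgebraicClosure F)).toMulEquiv) p).symm

/-- **The converse**: if `#μ_{p'}(E) + 1 = q^[E:F]` then `I_F ≤ G_E`.  With `m` the least
positive degree in `W_F ∩ G_E` (attained by `w₀`): every `ζ ∈ μ_{p'}(E)` is fixed by `w₀`, so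
`ζ^(q^m) = ζ` and `q^[E:F] - 1 = #μ_{p'}(E) ≤ q^m - 1`, i.e. `[E:F] ≤ m`; and
`W_F ∩ G_E ≤ deg⁻¹(mℤ)` with indices `[E:F]` and `m`, so `m ∣ [E:F]`, `m = [E:F]`,
`W_F ∩ G_E = deg⁻¹(mℤ) ⊇ I_F`. [cite: MochizukiAbsAnab2004, Prop 1.2.1 (ii) proof p.11] -/
theorem absInertia_le_galFixing_of_natCard_eq {p : ℕ} (hp : ringChar 𝓀[F] = p)
    (E : IntermediateField F (AlgebraicClosure F)) [FiniteDimensional F E]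
    (hcard : Nat.card (primeToRootsOfUnity p E) + 1 = residueFieldCard F ^ Module.finrank F E) :
    absInertia F ≤ galFixing F E := by
  classical
  haveI := finiteIndex_fieldSubgroup F E
  set n := Module.finrank F E with hn
  have hnpos : 0 < n := Module.finrank_pos
  have hq : 2 ≤ residueFieldCard F := one_lt_residueFieldCard F
  obtain ⟨m, hm, ⟨w₀, hw₀U, hw₀⟩, hdvd⟩ := exists_least_pos_deg (fieldSubgroup F E)
  set M := residueFieldCard F ^ m - 1 with hM
  have hM0 : M ≠ 0 := residueFieldCard_pow_sub_one_ne_zero F m hm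
  -- every prime-to-`p` root of unity of `E` is an `M`-th root of unity
  have hS : ∀ x : AlgebraicClosure F, x ∈ Polynomial.nthRoots M (1 : AlgebraicClosure F) ↔
      x ^ M = 1 := fun x => Polynomial.mem_nthRoots (Nat.pos_of_ne_zero hM0)
  let S := {x : AlgebraicClosure F // x ∈ Polynomial.nthRoots M (1 : AlgebraicClosure F)}
  let ι : primeToRootsOfUnity p E → S := fun x => ⟨((x.1 : E) : AlgebraicClosure F), by
    obtain ⟨N, hN, hpN, hxN⟩ := x.2
    rw [hS]
    have hζN : ((x.1 : E) : AlgebraicClosure F) ^ N = 1 := by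
      rw [← SubmonoidClass.coe_pow, hxN]; rfl
    rw [← hp] at hpN
    have hζ0 : ((x.1 : E) : AlgebraicClosure F) ≠ 0 := by
      intro h0; rw [h0, zero_pow hN.ne'] at hζN; exact zero_ne_one hζN
    have hfix := (mem_fieldSubgroup_iff F).mp hw₀U _ (x.1 : E).2
    rw [smul_eq_pow_of_deg_eq' hpN hN.ne' hw₀ hζN] at hfix
    -- `ζ^(q^m) = ζ ⇒ ζ^(q^m - 1) = 1`
    have hq1 : 1 ≤ residueFieldCard F ^ m := Nat.one_le_pow _ _ (by omega)
    apply mul_right_cancel₀ hζ0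
    rw [← pow_succ, hM, Nat.sub_add_cancel hq1, hfix, one_mul]⟩
  have hιinj : Function.Injective ι := by
    intro x y hxy
    have h := congrArg Subtype.val hxy
    exact Subtype.ext (Subtype.ext h)
  -- counting: `q^n - 1 ≤ q^m - 1`
  haveI : NeZero M := ⟨hM0⟩
  haveI : NeZero (M : F) := ⟨by exact_mod_cast hM0⟩
  haveI : Finite S := Finite.of_equiv _ (rootsOfUnityEquivNthRoots (AlgebraicClosure F) M)
  have hle : residueFieldCard F ^ n - 1 ≤ M := by
    have h1 : Nat.card (primeToRootsOfUnity p E) ≤ Nat.card S := Nat.card_le_card_of_injective ι hιinj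
    have h2 : Nat.card S = M := by
      rw [Nat.card_congr (rootsOfUnityEquivNthRoots (AlgebraicClosure F) M).symm,
        HasEnoughRootsOfUnity.natCard_rootsOfUnity]
    omega
  have hnm : n ≤ m := by
    have h1 : residueFieldCard F ^ n ≤ residueFieldCard F ^ m := by
      have := Nat.one_le_pow n _ (by omega : 0 < residueFieldCard F)
      have := Nat.one_le_pow m _ (by omega : 0 < residueFieldCard F)
      omega
    exact (Nat.pow_le_pow_iff_right hq).mp h1
  -- indices: `[W : W ∩ G_E] = n`, `[W : deg⁻¹(mℤ)] = m`, and `W ∩ G_E ≤ deg⁻¹(mℤ)`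
  have hDm : ∀ v : WeilGroup F, v ∈ AbstractCFT.degMultiples (degHom F) m ↔
      (m : ℤ) ∣ WeilGroup.deg v := fun v => by
    rw [AbstractCFT.mem_degMultiples_iff, degZ_degHom]
  have hUle : fieldSubgroup F E ≤ AbstractCFT.degMultiples (degHom F) m :=
    fun v hv => (hDm v).mpr (hdvd v hv)
  have hidxU : (fieldSubgroup F E).index = n := by
    rw [index_fieldSubgroup_eq, index_galFixing_eq_finrank]
  have hidxD : (AbstractCFT.degMultiples (degHom F) m).index = m := index_degMultiples hm _ hDm
  have hmn : m ∣ n := by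
    rw [← hidxU, ← hidxD]; exact Subgroup.index_dvd_of_le hUle
  have hmeq : m = n := le_antisymm (Nat.le_of_dvd hnpos hmn) hnm
  -- hence `W ∩ G_E = deg⁻¹(mℤ)`
  have hDU : AbstractCFT.degMultiples (degHom F) m ≤ fieldSubgroup F E := by
    have h := Subgroup.relIndex_mul_index hUle
    rw [hidxU, hidxD, ← hmeq] at h
    have h1 : (fieldSubgroup F E).relIndex (AbstractCFT.degMultiples (degHom F) m) = 1 :=
      Nat.eq_of_mul_eq_mul_right hm (by rw [h, one_mul])
    exact Subgroup.relIndex_eq_one.mp h1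
  -- and `I_F ≤ G_E`
  intro σ hσ
  obtain ⟨w, hwσ, hw0⟩ := exists_weilGroup_of_mem_absInertia hσ
  rw [← hwσ, toAbsGalois_mem_galFixing_iff]
  apply hDU
  rw [hDm, hw0]
  exact dvd_zero _

end Local

end Literature.AnabelianGeometry.AbsoluteAnabelian
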